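import Literature.Analysis.FunctionSpaces.TorusSpaceTime
import Mathlib.Analysis.SpecialFunctions.Sqrt
import HarnessLib

/-!
# Joint space–time smoothness on `T^d`: composition with smooth functions of the values,
time-only factors, square roots, space rescaling, Pi-valued fields

Analysis/FunctionSpaces support file: closure properties of the accepted
`Torus.IsSmoothSpaceTimeOn S u` (`TorusCalculus`: the space–time lift is `C^∞` on `S ×ˢ univ`)
that the explicit perturbations of convex-integration schemes need and `TorusSpaceTime` does not
yet record (it has `add/sub/smul/mul/inner/clm_comp/sum/partialDeriv/laplacian/…`):

* `IsSmoothSpaceTimeOn.comp_contDiff`, `.comp_contDiffOn` — post-composition with a smooth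
  (resp. smooth on a set containing all values) NONLINEAR function of the values
  (e.g. the geometric-lemma coefficients `Γ_k(Id - R/ρ)` of Cheskidov–Luo 2022, (4.12), smooth on a
  ball; `.sqrt` for fields bounded below by a positive constant, `ρ^{1/2}` in (4.12));
* `isSmoothSpaceTimeOn_of_time`, `IsSmoothSpaceTimeOn.time_smul` — factors depending on time
  only and smooth within `S` (the intermittent factors `θ(t) g_κ(νt)` of (4.12));
* `IsSmoothSpaceTimeOn.comp_nsmul` — the space rescaling `u(t, σ • x)`, `σ ∈ ℕ` (the oscillation
  `W_k(σx)` of (4.12));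
* `isSmoothSpaceTimeOn_pi` — matrix/tensor-valued fields componentwise.

All one-line consequences of Mathlib's `ContDiffOn.comp`, `contDiffOn_pi`. [folklore]

## References

* A. Cheskidov, X. Luo, Invent. Math. 229 (2022) = arXiv:2009.06596, §4.4 (4.12)–(4.15) (the
  fields whose joint smoothness these rules certify). [`CheskidovLuo2022`]
-/

noncomputable section

open Set Function
open scoped ContDiff

namespace Literature.Analysis.FunctionSpaces

namespace Torus

variable {d : Type*} [Fintype d]
variable {F G : Type*} [NormedAddCommGroup F] [NormedSpace ℝ F] [NormedAddCommGroup G] [NormedSpace ℝ G]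
variable {S : Set ℝ} {u : ℝ → UnitAddTorus d → F}

/-- **Composition with a smooth function of the values** preserves joint smoothness. [folklore] -/
theorem IsSmoothSpaceTimeOn.comp_contDiff {g : F → G} (hg : ContDiff ℝ ∞ g) (hu : IsSmoothSpaceTimeOn S u) :
    IsSmoothSpaceTimeOn S (fun t x => g (u t x)) :=
  hg.comp_contDiffOn hu

/-- **Composition with a function smooth on a set containing the values** preserves joint
smoothness (e.g. `√·` on `(0, ∞)`, or the coefficients of the geometric lemma on their ball). [folklore] -/
theorem IsSmoothSpaceTimeOn.comp_contDiffOn {g : F → G} {U : Set F} (hg : ContDiffOn ℝ ∞ g U)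
    (hu : IsSmoothSpaceTimeOn S u) (hmaps : ∀ t ∈ S, ∀ x, u t x ∈ U) :
    IsSmoothSpaceTimeOn S (fun t x => g (u t x)) := by
  refine hg.comp hu fun z hz => ?_
  obtain ⟨ht, -⟩ := mem_prod.1 hz
  exact hmaps z.1 ht (proj z.2)

/-- Square roots of jointly smooth fields bounded below by a positive constant are jointly
smooth. [folklore] -/
theorem IsSmoothSpaceTimeOn.sqrt {ρ : ℝ → UnitAddTorus d → ℝ} (hρ : IsSmoothSpaceTimeOn S ρ)
    (hpos : ∀ t ∈ S, ∀ x, 0 < ρ t x) : IsSmoothSpaceTimeOn S (fun t x => Real.sqrt (ρ t x)) :=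
  hρ.comp_contDiffOn (U := Ioi 0) (fun _ hs => (Real.contDiffAt_sqrt (ne_of_gt hs)).contDiffWithinAt) hpos

/-- Functions of time alone, smooth within `S`, are jointly smooth fields. [folklore] -/
theorem isSmoothSpaceTimeOn_of_time {θ : ℝ → G} (hθ : ContDiffOn ℝ ∞ θ S) :
    IsSmoothSpaceTimeOn S (fun t (_ : UnitAddTorus d) => θ t) := by
  have h : stLift (fun t (_ : UnitAddTorus d) => θ t) = θ ∘ Prod.fst := by funext z; rfl
  unfold IsSmoothSpaceTimeOn
  rw [h]
  exact hθ.comp contDiff_fst.contDiffOn fun z hz => (mem_prod.1 hz).1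

/-- Products of a time-only smooth factor with a jointly smooth field. [folklore] -/
theorem IsSmoothSpaceTimeOn.time_smul {θ : ℝ → ℝ} (hθ : ContDiffOn ℝ ∞ θ S) (hu : IsSmoothSpaceTimeOn S u) :
    IsSmoothSpaceTimeOn S (fun t x => θ t • u t x) :=
  (isSmoothSpaceTimeOn_of_time hθ).smul hu

omit [Fintype d] in
/-- `proj (n y) = n • proj y` (same statement as `Literature.Analysis.FluidPDE.proj_natCast_smul` of
`FluidPDE/ZerothLawProofs`, reproved here to keep this file inside `FunctionSpaces`). [folklore] -/
private theorem proj_natCast_smul' (n : ℕ) (y : EuclideanSpace ℝ d) : proj ((n : ℝ) • y) = n • proj y := by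
  funext i
  rw [proj_smul_apply, Pi.smul_apply, proj_apply, ← nsmul_eq_mul, AddCircle.coe_nsmul]

/-- **Space rescaling by a natural number** preserves joint smoothness: `(t, x) ↦ u(t, n • x)`. [folklore] -/
theorem IsSmoothSpaceTimeOn.comp_nsmul (hu : IsSmoothSpaceTimeOn S u) (n : ℕ) :
    IsSmoothSpaceTimeOn S (fun t x => u t (n • x)) := by
  have h : stLift (fun t x => u t (n • x)) = stLift u ∘ fun z : ℝ × EuclideanSpace ℝ d => (z.1, (n : ℝ) • z.2) := by
    funext z
    simp [stLift, proj_natCast_smul']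
  unfold IsSmoothSpaceTimeOn
  rw [h]
  refine hu.comp (contDiff_fst.prodMk (contDiff_snd.const_smul (n : ℝ))).contDiffOn fun z hz => ?_
  exact mem_prod.2 ⟨(mem_prod.1 hz).1, mem_univ _⟩

/-- Pi-valued fields: jointly smooth iff every component is. [folklore] -/
theorem isSmoothSpaceTimeOn_pi {ι : Type*} [Fintype ι] {E : ι → Type*} [∀ i, NormedAddCommGroup (E i)]
    [∀ i, NormedSpace ℝ (E i)] {w : ℝ → UnitAddTorus d → ∀ i, E i} :
    IsSmoothSpaceTimeOn S w ↔ ∀ i, IsSmoothSpaceTimeOn S (fun t x => w t x i) := by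
  unfold IsSmoothSpaceTimeOn
  rw [contDiffOn_pi]
  rfl

end Torus
end Literature.Analysis.FunctionSpaces
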